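import Summits.ResolutionOfSingularities.ResolutionOfSingularities.Theorems.FrobeniusLadderFInjectiveMacaulayficationPinchSingularLocus
import Summits.ResolutionOfSingularities.ResolutionOfSingularities.Theorems.FrobeniusLadderFInjectiveMacaulayficationX2CubicFormChart
import HarnessLib

/-!
# (T-I3, habitat #3a) THE QUARTIC CHART PACKAGE: a chart `X₄² + X_a²·W` of the point floor of a quartic double point `x² + F₄`, with `V(W)` SMOOTH, is carried onto the pinch model
# `Λ[x′, y]/(x′² + y²·w)` (`Λ = k[Y₀,Y₁,Y₂]`) — `Sing = V(X₄, X_a)`, the centre is prime, and the blowing up along `(X₄, X_a)` is REGULAR (`2 ≠ 0` in `k`)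
# (crux `FInjectiveMacaulayfication` stmt-ResolutionOfSingularities-15315, chain w45a; `Lines/T-I3-firststep.md` §3 #3a; seat res-L1-w45a-lead-1 g11)

[OURS · L1 W4.5a] Support file (`--supports stmt-ResolutionOfSingularities-15315 --as helper`); def-free; UNCONDITIONAL; no named fact; NOT a statement of any manuscript. Mirror image of
✓p680244 `X2CubicFormChart` for the quartic habitat, over ✓p685811 `PinchStrictTransform` and ✓/⧗p686051 `PinchSingularLocus`. Evidence for nothing beyond itself; T″ and the F-half
OPEN; nothing of the crux proved. AI-written (AI review is weaker than expert review).

* §1 model-level complements: `isPrime_map_span_cen` (`J = (x′, y)·C` is prime: `C/J ≅ Λ`), `isRegular_affineBlowup_of_two_charts` (generic).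
* §2 `exists_quotientEquiv_chart4` — the quotient bridge `k[X]/(X₄² + X_a²·rename e w) ≃+* Λ[T]/(T₀² + T₁²·C w)` carrying `(X₄, X_a)` onto `(T₀, T₁)`; `transport_of_quotientEquiv₂`.
* §3 ★★ `chart_package4` — for `w ∈ k[Y₀,Y₁,Y₂]` with smooth zero locus and `2 ≠ 0`: the chart rings `C_a[J/x̄₄]`, `C_a[J/x̄_a]` are regular ∧ `Sing(Spec C_a) = V(J)` ∧ `J` prime;
  ★★ `isRegular_affineBlowup_chart4` — `Bl_J Spec C_a` is a REGULAR SCHEME.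
[folklore; cite: Liu2002, Thm. 8.1.19 (a); StacksProject, Tag 07PF, Tag 0BIQ; GortzWedhorn2020, Prop. 13.96 (2), Prop. 13.91 (4)]
-/

-- single-problem summit: the doubled namespace component is forced
set_option linter.dupNamespace false

noncomputable section

namespace Summit.ResolutionOfSingularities.ResolutionOfSingularities.Theorems.FInjectiveMacaulayfication.QuarticChart

open MvPolynomial Literature.AlgebraicGeometry.Resolution AlgebraicGeometry
open Summit.ResolutionOfSingularities.ResolutionOfSingularities.Theorems.FInjectiveMacaulayfication

universe u

/-! ## §1 Model-level complements -/

/-- **The centre `J = (x′, y)·C` of the pinch model is a prime ideal** (`Λ` a domain): `I = (T₀, T₁)` is prime (`R/I ≅ Λ`) and contains `ker (R → C) = (h)` (`h ∈ I²`). [folklore] -/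
theorem isPrime_map_span_cen {Λ : Type u} [CommRing Λ] [IsDomain Λ] (g : Λ) (cen : Fin 2 → MvPolynomial (Fin 2) Λ) (h : MvPolynomial (Fin 2) Λ)
    (hcen : cen = ![X 0, X 1]) (hh : h = X 0 ^ 2 + X 1 ^ 2 * C g) :
    ((Ideal.span (Set.range cen)).map (Ideal.Quotient.mk (Ideal.span {h}))).IsPrime := by
  haveI := PinchStrictTransform.isDomain_quotient cen hcen
  haveI : (Ideal.span (Set.range cen)).IsPrime := (Ideal.Quotient.isDomain_iff_prime _).mp inferInstance
  refine Ideal.map_isPrime_of_surjective Ideal.Quotient.mk_surjective ?_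
  rw [Ideal.mk_ker, Ideal.span_le, Set.singleton_subset_iff]
  exact Ideal.pow_le_self two_ne_zero (PinchSingularLocus.h_mem_sq g cen h hcen hh)

/-- **`Bl_{(c₀, c₁)} Spec A` is a regular scheme as soon as both chart rings are** (the charts at the generators cover). [cite: GortzWedhorn2020, Prop. 13.91 (4), (13.19)] -/
theorem isRegular_affineBlowup_of_two_charts {A : Type u} [CommRing A] (J : Ideal A) (c : Fin 2 → A) (hJ : J = Ideal.span (Set.range c))
    (h0 : IsRegularRing (blowupAlgebra J (c 0))) (h1 : IsRegularRing (blowupAlgebra J (c 1))) : Scheme.IsRegular (affineBlowup J) := by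
  refine affineBlowup.isRegular_of_isRegularRing_blowupAlgebra_of_pow_le (I := J) c (fun l => by rw [hJ]; exact Ideal.subset_span ⟨l, rfl⟩) (N := 1)
    (by rw [← hJ]; exact le_of_eq (pow_succ' J 1)) fun l => ?_
  fin_cases l
  · exact h0
  · exact h1

/-! ## §2 The quotient bridge for a chart `X₄² + X_a² · rename e w` -/

/-- **The quotient bridge `k[X]/(G) ≃+* Λ[T]/(h)`** (`G = X₄² + X_a²·rename e w`, `h = T₀² + T₁²·C(ι w)`) carrying the centre `(X₄, X_a)` onto `(T₀, T₁)`, for a splitting with `π 4 = inl 0`,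
`π a = inl 1`, `π ∘ e = inr`. [plumbing] -/
theorem exists_quotientEquiv_chart4 (k : Type) [Field k] {Λ : Type} [CommRing Λ] (ι : MvPolynomial (Fin 3) k ≃+* Λ) (π : Fin 5 ≃ Fin 2 ⊕ Fin 3) (a : Fin 5)
    (h4 : π 4 = Sum.inl 0) (ha : π a = Sum.inl 1) (e : Fin 3 → Fin 5) (he : ∀ i, π (e i) = Sum.inr i) (w : MvPolynomial (Fin 3) k)
    (G : MvPolynomial (Fin 5) k) (hG : G = X 4 ^ 2 + X a ^ 2 * rename e w)
    (c : Fin 2 → MvPolynomial (Fin 5) k) (hc : c = ![X 4, X a])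
    (J : Ideal (MvPolynomial (Fin 5) k ⧸ Ideal.span {G})) (hJ : J = (Ideal.span (Set.range c)).map (Ideal.Quotient.mk (Ideal.span {G})))
    (g : Λ) (hg : g = ι w) (cen : Fin 2 → MvPolynomial (Fin 2) Λ) (hcen : cen = ![X 0, X 1])
    (h : MvPolynomial (Fin 2) Λ) (hh : h = X 0 ^ 2 + X 1 ^ 2 * C g) :
    ∃ εq : (MvPolynomial (Fin 5) k ⧸ Ideal.span {G}) ≃+* (MvPolynomial (Fin 2) Λ ⧸ Ideal.span {h}),
      (∀ q, εq (Ideal.Quotient.mk (Ideal.span {G}) (c q)) = Ideal.Quotient.mk (Ideal.span {h}) (cen q)) ∧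
        Ideal.map εq J = (Ideal.span (Set.range cen)).map (Ideal.Quotient.mk (Ideal.span {h})) := by
  obtain ⟨ε, hεX, hεC⟩ := X2CubicFormChart.exists_ringEquiv_fin5_of_perm k ι π
  have e4 : ε (X 4) = X 0 := by rw [hεX, h4]; rfl
  have ea : ε (X a) = X 1 := by rw [hεX, ha]; rfl
  have ew : ε (rename e w) = C g := by rw [hg]; exact X2CubicFormChart.apply_rename_eq_C k ι π ε hεX hεC e he w
  have hεg : ε G = h := by rw [hG, hh, map_add, map_pow, map_mul, map_pow, e4, ea, ew]
  have hεc : ∀ q, ε (c q) = cen q := by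
    intro q
    subst hc hcen
    fin_cases q
    · exact e4
    · exact ea
  have hmap : Ideal.span {h} = (Ideal.span {G}).map (ε : MvPolynomial (Fin 5) k →+* MvPolynomial (Fin 2) Λ) := by
    rw [Ideal.map_span, Set.image_singleton]
    exact congrArg _ (congrArg _ hεg.symm)
  let εq := Ideal.quotientEquiv (Ideal.span {G}) (Ideal.span {h}) ε hmap
  have hεq : ∀ x, εq (Ideal.Quotient.mk (Ideal.span {G}) x) = Ideal.Quotient.mk (Ideal.span {h}) (ε x) := fun x =>
    Ideal.quotientEquiv_mk _ _ _ _ x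
  refine ⟨εq, fun q => by rw [hεq, hεc], ?_⟩
  have hcomp : (εq : _ →+* _).comp (Ideal.Quotient.mk (Ideal.span {G})) =
      (Ideal.Quotient.mk (Ideal.span {h})).comp (ε : MvPolynomial (Fin 5) k →+* MvPolynomial (Fin 2) Λ) :=
    RingHom.ext fun x => hεq x
  have hfun : ((ε : MvPolynomial (Fin 5) k →+* MvPolynomial (Fin 2) Λ) ∘ c : Fin 2 → _) = cen :=
    funext fun q => by rw [Function.comp_apply, RingEquiv.coe_toRingHom]; exact hεc q
  have key : Ideal.map (εq : _ →+* _) J = (Ideal.span (Set.range cen)).map (Ideal.Quotient.mk (Ideal.span {h})) := by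
    rw [hJ, Ideal.map_map, hcomp, ← Ideal.map_map, Ideal.map_span, ← Set.range_comp, hfun]
  exact key

/-- **Transport package along a quotient bridge matching two-generator centres**: both chart-ring regularities, `Sing = V(J)` and primality descend. [plumbing] -/
theorem transport_of_quotientEquiv₂ {A B : Type} [CommRing A] [CommRing B] (εq : A ≃+* B) (c' : Fin 2 → A) (c : Fin 2 → B)
    (hc : ∀ p, εq (c' p) = c p) (J' : Ideal A) (J : Ideal B) (hJ : Ideal.map εq J' = J)
    (hreg : IsRegularRing (blowupAlgebra J (c 0)) ∧ IsRegularRing (blowupAlgebra J (c 1)))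
    (hsing : ∀ (Q : Ideal B) [Q.IsPrime], ¬ IsRegularLocalRing (Localization.AtPrime Q) ↔ J ≤ Q) (hprime : J.IsPrime) :
    (IsRegularRing (blowupAlgebra J' (c' 0)) ∧ IsRegularRing (blowupAlgebra J' (c' 1))) ∧
      (∀ (P : Ideal A) [P.IsPrime], ¬ IsRegularLocalRing (Localization.AtPrime P) ↔ J' ≤ P) ∧ J'.IsPrime := by
  have hJ'c : J' = J.comap εq := by
    rw [← hJ]; exact (Ideal.comap_map_of_bijective εq εq.bijective).symm
  refine ⟨⟨E4FloorTwoWChart.isRegularRing_blowupAlgebra_of_ringEquiv εq J' (c' 0) J (c 0) hJ.symm (hc 0).symm hreg.1,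
    E4FloorTwoWChart.isRegularRing_blowupAlgebra_of_ringEquiv εq J' (c' 1) J (c 1) hJ.symm (hc 1).symm hreg.2⟩, fun P _ => ?_, ?_⟩
  · haveI hQ : (P.map εq).IsPrime := Ideal.map_isPrime_of_equiv εq
    have hPc : P = (P.map εq).comap εq := (Ideal.comap_map_of_bijective εq εq.bijective).symm
    rw [E4FloorTwoWChart.isRegularLocalRing_localization_iff_of_ringEquiv εq P (P.map εq) hPc, hsing, ← hJ, Ideal.map_le_iff_le_comap, ← hPc]
  · rw [hJ'c]; exact Ideal.comap_isPrime εq J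

/-! ## §3 The quartic chart package -/

/-- ★★ **THE QUARTIC CHART PACKAGE.** `w ∈ k[Y₀,Y₁,Y₂]` with smooth zero locus (`∀` prime `Q ∋ w` `∃ D`, `D w ∉ Q`), `2 ≠ 0` in `k`, chart ring `C_a = k[X]/(G)`, `G = X₄² + X_a²·rename e w`,
centre `J = (X₄, X_a)·C_a` (any `a`, any splitting `π` with `π 4 = inl 0`, `π a = inl 1`, `π ∘ e = inr`): the chart rings `C_a[J/x̄₄]`, `C_a[J/x̄_a]` are REGULAR, `Sing(Spec C_a) = V(J)`,
and `J` is PRIME. [folklore; cite: Liu2002, Thm. 8.1.19 (a); StacksProject, Tag 07PF] -/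
theorem chart_package4 (k : Type) [Field k] (h2 : (2 : k) ≠ 0) (π : Fin 5 ≃ Fin 2 ⊕ Fin 3) (a : Fin 5) (h4 : π 4 = Sum.inl 0) (ha : π a = Sum.inl 1)
    (e : Fin 3 → Fin 5) (he : ∀ i, π (e i) = Sum.inr i) (w : MvPolynomial (Fin 3) k)
    (hws : ∀ Q : Ideal (MvPolynomial (Fin 3) k), Q.IsPrime → w ∈ Q → ∃ D : Derivation k (MvPolynomial (Fin 3) k) (MvPolynomial (Fin 3) k), D w ∉ Q)
    (G : MvPolynomial (Fin 5) k) (hG : G = X 4 ^ 2 + X a ^ 2 * rename e w)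
    (c : Fin 2 → MvPolynomial (Fin 5) k) (hc : c = ![X 4, X a])
    (J : Ideal (MvPolynomial (Fin 5) k ⧸ Ideal.span {G})) (hJ : J = (Ideal.span (Set.range c)).map (Ideal.Quotient.mk (Ideal.span {G}))) :
    (IsRegularRing (blowupAlgebra J (Ideal.Quotient.mk (Ideal.span {G}) (c 0))) ∧
        IsRegularRing (blowupAlgebra J (Ideal.Quotient.mk (Ideal.span {G}) (c 1)))) ∧
      (∀ (P : Ideal (MvPolynomial (Fin 5) k ⧸ Ideal.span {G})) [P.IsPrime], ¬ IsRegularLocalRing (Localization.AtPrime P) ↔ J ≤ P) ∧ J.IsPrime := by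
  have h2u : IsUnit (2 : MvPolynomial (Fin 3) k) := by
    rw [show (2 : MvPolynomial (Fin 3) k) = C (2 : k) by rw [map_ofNat]]; exact (isUnit_iff_ne_zero.mpr h2).map C
  obtain ⟨εq, hεq, hJ'⟩ := exists_quotientEquiv_chart4 k (RingEquiv.refl _) π a h4 ha e he w G hG c hc J hJ w rfl _ rfl _ rfl
  have hreg := PinchStrictTransform.isRegularRing_blowupAlgebra_pinch w (![X 0, X 1] : Fin 2 → MvPolynomial (Fin 2) (MvPolynomial (Fin 3) k)) _ h2u hws rfl rfl _ rfl
  have hsing := fun (P : Ideal (MvPolynomial (Fin 2) (MvPolynomial (Fin 3) k) ⧸ Ideal.span {(X 0 ^ 2 + X 1 ^ 2 * C w : MvPolynomial (Fin 2) (MvPolynomial (Fin 3) k))}))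
    (hP : P.IsPrime) => PinchSingularLocus.not_isRegularLocalRing_iff_map_le w (![X 0, X 1] : Fin 2 → MvPolynomial (Fin 2) (MvPolynomial (Fin 3) k)) _ h2u hws rfl rfl P
  have hprime := isPrime_map_span_cen w (![X 0, X 1] : Fin 2 → MvPolynomial (Fin 2) (MvPolynomial (Fin 3) k)) _ rfl rfl
  exact transport_of_quotientEquiv₂ εq _ _ hεq J _ hJ' hreg (fun P hP => hsing P hP) hprime

/-- ★★ **`Bl_J Spec C_a` IS A REGULAR SCHEME** under the hypotheses of `chart_package4`. [folklore; cite: GortzWedhorn2020, Prop. 13.91 (4)] -/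
theorem isRegular_affineBlowup_chart4 (k : Type) [Field k] (h2 : (2 : k) ≠ 0) (π : Fin 5 ≃ Fin 2 ⊕ Fin 3) (a : Fin 5) (h4 : π 4 = Sum.inl 0) (ha : π a = Sum.inl 1)
    (e : Fin 3 → Fin 5) (he : ∀ i, π (e i) = Sum.inr i) (w : MvPolynomial (Fin 3) k)
    (hws : ∀ Q : Ideal (MvPolynomial (Fin 3) k), Q.IsPrime → w ∈ Q → ∃ D : Derivation k (MvPolynomial (Fin 3) k) (MvPolynomial (Fin 3) k), D w ∉ Q)
    (G : MvPolynomial (Fin 5) k) (hG : G = X 4 ^ 2 + X a ^ 2 * rename e w)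
    (c : Fin 2 → MvPolynomial (Fin 5) k) (hc : c = ![X 4, X a])
    (J : Ideal (MvPolynomial (Fin 5) k ⧸ Ideal.span {G})) (hJ : J = (Ideal.span (Set.range c)).map (Ideal.Quotient.mk (Ideal.span {G}))) :
    Scheme.IsRegular (affineBlowup J) := by
  obtain ⟨⟨r0, r1⟩, -, -⟩ := chart_package4 k h2 π a h4 ha e he w hws G hG c hc J hJ
  refine isRegular_affineBlowup_of_two_charts J (fun l => Ideal.Quotient.mk (Ideal.span {G}) (c l)) ?_ r0 r1
  rw [hJ, Ideal.map_span, ← Set.range_comp]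
  rfl

end Summit.ResolutionOfSingularities.ResolutionOfSingularities.Theorems.FInjectiveMacaulayfication.QuarticChart

end
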